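import Summits.CriticalPhenomena.CardyFormulaZ2.Theorems.CardyIKTransportIKLinearTransportPinnedDefs
import Summits.CriticalPhenomena.CardyFormulaZ2.Theorems.CardyIKTransportIKLinearTransportStubPinnedExchange

/-!
# Stub `stub_StripDiagramExchange` (line `pinned-diagram-exchange`, crux stmt-CriticalPhenomena-5076) — part 1

The MEASURE-LEVEL off-data identity behind `StripDiagramExchange S i`: for adjacent face columns
`i, i+1` of different type, the law of the observables with the middle data erased,
`(νmix S).map (eraseMid i)`, is the same for `S` and `S ∆ {i, i+1}`. It is the measure form of the
landed event-level consistency `nuMix_symmDiff_apply_eq` (a `μIK`-preserving plaquette-column swap).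
-/

set_option autoImplicit false

noncomputable section

namespace Summit.CriticalPhenomena.CardyFormulaZ2.Theorems.IKLinearTransport.PinnedDiagramExchange

open scoped Classical MeasureTheory ENNReal symmDiff
open Set MeasureTheory
open Literature.Probability.Percolation Literature.Probability.LatticeModels

/-- `eraseMid i` is measurable. [folklore] -/
theorem measurable_eraseMid (i : ℤ) : Measurable (eraseMid i) := by
  refine (measurable_set_iff.2 fun v => ?_).prodMk (measurable_set_iff.2 fun f => ?_)
  · simp only [Set.mem_setOf_eq]
    exact ((measurable_set_mem v).comp measurable_fst).and measurable_const
  · simp only [Set.mem_setOf_eq]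
    exact ((measurable_set_mem f).comp measurable_snd).and measurable_const

/-- Two observable configurations agreeing off cell column `i+1` / face columns `i, i+1` have the
same erased configuration. [folklore] -/
theorem eraseMid_eq_of_agree (i : ℤ) (x y : Obs)
    (h1 : ∀ v : Site 2, v 0 ≠ i + 1 → (v ∈ x.1 ↔ v ∈ y.1))
    (h2 : ∀ f : Site 2, f 0 ≠ i → f 0 ≠ i + 1 → (f ∈ x.2 ↔ f ∈ y.2)) :
    eraseMid i x = eraseMid i y := by
  refine Prod.ext (Set.ext fun v => ?_) (Set.ext fun f => ?_)
  · simp only [eraseMid, Set.mem_setOf_eq]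
    exact ⟨fun h => ⟨(h1 v h.2).1 h.1, h.2⟩, fun h => ⟨(h1 v h.2).2 h.1, h.2⟩⟩
  · simp only [eraseMid, Set.mem_setOf_eq]
    exact ⟨fun h => ⟨(h2 f h.2.1 h.2.2).1 h.1, h.2⟩, fun h => ⟨(h2 f h.2.1 h.2.2).2 h.1, h.2⟩⟩

/-- OFF-DATA IDENTITY (measure level): for adjacent face columns `i, i+1` of different type, the law
of the erased observables `eraseMid i` is the same under `νmix S` and `νmix (S ∆ {i, i+1})`. [folklore] -/
theorem nuMix_map_eraseMid_eq : ∀ (S : Set ℤ) (i : ℤ), (i ∈ S ↔ i + 1 ∉ S) →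
    (νmix S).map (eraseMid i) = (νmix (symmDiff S {i, i + 1})).map (eraseMid i) := by
  intro S i h
  refine Measure.ext fun E hE => ?_
  rw [Measure.map_apply (measurable_eraseMid i) hE, Measure.map_apply (measurable_eraseMid i) hE]
  refine (nuMix_symmDiff_apply_eq S i h _ (measurable_eraseMid i hE) fun x y h1 h2 => ?_).symm
  simp only [Set.mem_preimage]
  rw [eraseMid_eq_of_agree i x y h1 h2]

end Summit.CriticalPhenomena.CardyFormulaZ2.Theorems.IKLinearTransport.PinnedDiagramExchange
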